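import Mathlib.Algebra.Field.ZMod
import Mathlib.Algebra.Module.ZMod
import Mathlib.FieldTheory.Finite.Basic
import Mathlib.LinearAlgebra.Basis.VectorSpace
import Mathlib.LinearAlgebra.Dual.Lemmas
import Summits.MatrixMultiplication.OmegaCensus.AffineExtensionBoxF2
import Summits.MatrixMultiplication.OmegaCensus.BoxUsefulAtomConfig

/-!
# ω-census, family (b3): conjecture C9 (b) — the atom hypothesis `AtomBad p q` for ALL primes `p ≠ q` with `q ∤ p − 1`

HONEST FRAMING (pub-omega census; verbatim): lottery ticket; floor = certified bounds/negative ranges.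
Census BOOKKEEPING (conjecture C9 of the cell, STRUCTURE.md §2; pub-omega kernel-l4 gen 18, task K-8).  THE COPRIME HALF OF
THE ATOM HYPOTHESIS, UNIFORMLY: **for primes `p ≠ q` with `q ∤ p − 1` (no non-trivial `q`-th root of unity mod `p`, i.e. every
Schmidt atom `A(p,q) = 𝔽_{p^k} ⋊ C_q` has `k ≥ 2`), every finite group carrying an `A(p,q)`-configuration `AtomConfig p q a y` is
box-useless** (`atomBad_of_not_dvd`).  No case distinction on `k`, no model of `𝔽_{p^k}`, no irreducibility: the relation-form
data give an elementary abelian `p`-group `W = ⟨yⁱ a y⁻ⁱ⟩` with the automorphism `φ = (conjugation by y)` having no non-zero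
fixed vector, hence an embedding `AffExt.lift : (Additive W) ⋊_φ ℤ/ord(y) ↪ H`; a linear functional `λ : W → 𝔽_p` with
`λ(a) ≠ 0` exists (`Module.Projective.exists_dual_ne_zero` on the `𝔽_p`-space `W`), and because `𝔽_p` contains no `q`-th root
of unity `≠ 1` the pair `(λ, λ ∘ φ)` is jointly surjective (`exists_pair` — otherwise `λ(yⁱ a y⁻ⁱ) = rⁱ λ(a)` with `r^q = 1`,
so `r = 1` and the vanishing trace gives `q · λ(a) = 0`); `AffExt.not_boxUseful_of_twoRotation` (the uniform density-`2` coset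
pattern of `AffineExtensionBoxF2.lean`) finishes.  Combined with the rank-one half (`q ∣ p − 1`: `atomBad_of_frobenius_model`,
`BoxBadAtomsFrobeniusBridge/Models.lean`), the atom hypothesis is reduced to the Frobenius groups `C_p ⋊ C_q`, `q ∣ p − 1`.
Nothing here is progress on `ω`.
-/

namespace Summit.MatrixMultiplication.OmegaCensus

open Finset

universe u

/-! ### A little linear algebra over `𝔽_p` in relation form -/

namespace CoprimeAtom

variable {p q : ℕ}

/-- **No `q`-th roots of unity, jointly surjective pair.**  Let `s : ℕ → ZMod p` be `q`-periodic with `Σ_{i<q} s i = 0`,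
`s 0 ≠ 0`, where `p ≠ q` are primes and `ZMod p` has no `q`-th root of unity other than `1`.  Then some consecutive pair
`(s i, s (i+1))` is not proportional to `(s 0, s 1)`: `s 0 · s (i+1) ≠ s 1 · s i`. [folklore] -/
theorem exists_det_ne_zero [Fact p.Prime] (hq : q.Prime) (hpq : p ≠ q) (hroot : ∀ r : ZMod p, r ^ q = 1 → r = 1)
    (s : ℕ → ZMod p) (hsq : ∀ i, s (i + q) = s i) (hsum : ∑ i ∈ range q, s i = 0) (hs0 : s 0 ≠ 0) :
    ∃ i, s 0 * s (i + 1) - s 1 * s i ≠ 0 := by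
  by_contra hall
  push Not at hall
  set r : ZMod p := s 1 / s 0 with hr
  have hrec : ∀ i, s (i + 1) = r * s i := by
    intro i
    have h := hall i
    rw [sub_eq_zero] at h
    rw [hr, div_mul_eq_mul_div, eq_div_iff hs0, mul_comm (s (i + 1)), h]
  have hpow : ∀ i, s i = r ^ i * s 0 := by
    intro i
    induction i with
    | zero => simp
    | succ i ih => rw [hrec, ih, pow_succ]; ring
  have hrq : r ^ q = 1 := by
    have h := hsq 0
    rw [zero_add, hpow q] at h
    exact mul_right_cancel₀ hs0 (by rw [h, one_mul])
  have hr1 : r = 1 := hroot r hrq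
  have hconst : ∀ i, s i = s 0 := fun i => by rw [hpow, hr1, one_pow, one_mul]
  rw [sum_congr rfl fun i _ => hconst i, sum_const, card_range, nsmul_eq_mul] at hsum
  rcases mul_eq_zero.1 hsum with h | h
  · rw [ZMod.natCast_eq_zero_iff] at h
    exact hpq (((Nat.prime_dvd_prime_iff_eq (Fact.out) hq).1 h))
  · exact hs0 h

/-- **Elementary abelian `p`-groups have enough characters into `𝔽_p`.**  If every element of the abelian group `G` has order
dividing the prime `p`, every `a ≠ 1` is detected by an additive homomorphism `Additive G →+ ZMod p` (a linear functional of
the `𝔽_p`-vector space `G`; `Module.Projective.exists_dual_ne_zero`). [folklore] -/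
theorem exists_addMonoidHom_ne_zero [Fact p.Prime] {G : Type*} [CommGroup G] (h : ∀ x : Additive G, p • x = 0)
    {a : Additive G} (ha : a ≠ 0) : ∃ f : Additive G →+ ZMod p, f a ≠ 0 := by
  letI inst : Module (ZMod p) (Additive G) := AddCommGroup.zmodModule h
  haveI hproj : @Module.Projective (ZMod p) _ (Additive G) _ inst := by infer_instance
  obtain ⟨f, hf⟩ := @Module.Projective.exists_dual_ne_zero (Additive G) _ (ZMod p) _ inst hproj a ha
  exact ⟨f.toAddMonoidHom, hf⟩

end CoprimeAtom

/-! ### The bridge -/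

/-- **`q ∤ p − 1` ⇒ `AtomBad p q`.**  For primes `p ≠ q` such that `ZMod p` has no `q`-th root of unity other than `1`, every
finite group with an `A(p,q)`-configuration is box-useless. [folklore] -/
theorem atomBad_of_no_root {p q : ℕ} [hp : Fact p.Prime] (hq : q.Prime) (hpq : p ≠ q)
    (hroot : ∀ r : ZMod p, r ^ q = 1 → r = 1) : AtomBad.{u} p q := by
  intro H _ _ _ a y h
  classical
  haveI : Fact q.Prime := ⟨hq⟩
  obtain ⟨ha1, hap, hcomm, hyq, htr⟩ := h
  -- the abelian subgroup `W` generated by the conjugates, `y` normalises it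
  let c' : ℕ → H := fun i => y ^ i * a * (y ^ i)⁻¹
  set W : Subgroup H := Subgroup.closure (Set.range c') with hWdef
  have hSc : ∀ x ∈ Set.range c', ∀ z ∈ Set.range c', x * z = z * x := by
    rintro x ⟨i, rfl⟩ z ⟨j, rfl⟩; exact (hcomm i j).eq
  haveI hWcomm : IsMulCommutative W := Subgroup.isMulCommutative_closure hSc
  letI : CommGroup W := { (inferInstance : Group W) with mul_comm := hWcomm.is_comm.comm }
  have hWab : ∀ v ∈ W, ∀ w ∈ W, v * w = w * v := fun v hv w hw => by
    have := mul_comm (⟨v, hv⟩ : W) ⟨w, hw⟩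
    exact congrArg Subtype.val this
  have hc'mem : ∀ i, c' i ∈ W := fun i => Subgroup.subset_closure ⟨i, rfl⟩
  have haW : a ∈ W := by have := hc'mem 0; simpa [c'] using this
  have hc'succ : ∀ i, y * c' i * y⁻¹ = c' (i + 1) := by
    intro i; change y * (y ^ i * a * (y ^ i)⁻¹) * y⁻¹ = y ^ (i + 1) * a * (y ^ (i + 1))⁻¹
    rw [pow_succ']; group
  have hyW : ∀ x ∈ W, y * x * y⁻¹ ∈ W := by
    intro x hx
    have hmap : W.map (MulAut.conj y).toMonoidHom ≤ W := by
      rw [hWdef, MonoidHom.map_closure]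
      refine Subgroup.closure_le _ |>.2 ?_
      rintro _ ⟨_, ⟨i, rfl⟩, rfl⟩
      change y * c' i * y⁻¹ ∈ Subgroup.closure (Set.range c')
      rw [hc'succ]
      exact Subgroup.subset_closure ⟨i + 1, rfl⟩
    exact hmap ⟨x, hx, rfl⟩
  -- exponent `p`
  have hWp : ∀ x ∈ W, x ^ p = 1 := by
    intro x hx
    refine Subgroup.closure_induction (p := fun x _ => x ^ p = 1) ?_ (one_pow _) ?_ ?_ hx
    · rintro _ ⟨i, rfl⟩
      change (y ^ i * a * (y ^ i)⁻¹) ^ p = 1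
      rw [← MulAut.conj_apply, ← map_pow, hap, map_one]
    · intro v w hv hw hvp hwp
      rw [(show Commute v w from hWab v hv w hw).mul_pow, hvp, hwp, one_mul]
    · intro v _ hvp
      rw [inv_pow, hvp, inv_one]
  -- the conjugation trace vanishes on `W`, so `φ` has no fixed points on `W`
  have htrW : ∀ x ∈ W, conjTrace y x q = 1 := by
    intro x hx
    refine Subgroup.closure_induction (p := fun x _ => conjTrace y x q = 1) ?_ (conjTrace_one_right y q) ?_ ?_ hx
    · rintro _ ⟨i, rfl⟩
      induction i with
      | zero => simpa [c'] using htr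
      | succ i ih => rw [← hc'succ, ← conj_conjTrace, ih]; group
    · intro v w hv hw hv1 hw1
      rw [conjTrace_mul hWab hyW q hv hw, hv1, hw1, one_mul]
    · intro v hv hv1
      rw [conjTrace_inv hWab hyW q hv, hv1, inv_one]
  have hfixW : ∀ x ∈ W, y * x * y⁻¹ = x → x = 1 := by
    intro x hx hfx
    have key : ∀ m, conjTrace y x m = x ^ m := by
      intro m
      induction m with
      | zero => simp
      | succ m ih =>
        rw [conjTrace_succ, ih]
        have hc : y * x ^ m * y⁻¹ = (y * x * y⁻¹) ^ m := by rw [← MulAut.conj_apply, map_pow, MulAut.conj_apply]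
        rw [hc, hfx, pow_succ']
    have hxq : x ^ q = 1 := by rw [← key]; exact htrW x hx
    have hg : x ^ Nat.gcd p q = 1 := pow_gcd_eq_one.2 ⟨hWp x hx, hxq⟩
    rwa [(Nat.coprime_primes hp.out hq).2 hpq, pow_one] at hg
  -- the additive model `A = Additive W` with the endomorphism `φ`
  let φW : W →* W := ((MulAut.conj y).toMonoidHom.comp W.subtype).codRestrict W (fun x => hyW x x.2)
  have hφW_coe : ∀ x : W, ((φW x : W) : H) = y * x * y⁻¹ := fun x => rfl
  let A := Additive W
  let φ : AddMonoid.End A := MonoidHom.toAdditive φW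
  have hφ_apply : ∀ v : A, φ v = Additive.ofMul (φW (Additive.toMul v)) := fun v => rfl
  -- the embedding `A ⋊_φ ℤ/n ↪ H`, `n = orderOf y`
  let e : Multiplicative A →* H :=
    { toFun := fun x => ((Additive.toMul (Multiplicative.toAdd x) : W) : H)
      map_one' := rfl
      map_mul' := fun _ _ => rfl }
  have he_apply : ∀ v : A, e (Multiplicative.ofAdd v) = ((Additive.toMul v : W) : H) := fun v => rfl
  have he : Function.Injective e := by
    intro x x' hxx'
    exact Multiplicative.toAdd.injective (Additive.toMul.injective (Subtype.ext hxx'))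
  have hy : ∀ v : A, y * e (Multiplicative.ofAdd v) * y⁻¹ = e (Multiplicative.ofAdd (φ v)) := fun v => rfl
  set n := orderOf y with hn
  haveI : NeZero n := ⟨(orderOf_pos y).ne'⟩
  have hyn : y ^ n = 1 := pow_orderOf_eq_one y
  haveI hfact : Fact (φ ^ n = 1) := ⟨AffExt.twist_pow_orderOf e he y hy⟩
  have hy1 : y ≠ 1 := by
    intro hy1
    exact ha1 (hfixW a haW (by rw [hy1]; group))
  have hn2 : 1 < n := by
    rw [hn, Nat.lt_iff_add_one_le]
    have := orderOf_pos y
    rcases Nat.lt_or_ge 1 (orderOf y) with h | h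
    · exact h
    · exfalso; exact hy1 (orderOf_eq_one_iff.1 (by omega))
  haveI : Fact (1 < n) := ⟨hn2⟩
  have h1 : (1 : ZMod n) ≠ 0 := by
    intro h0
    have := congrArg ZMod.val h0
    rw [ZMod.val_one, ZMod.val_zero] at this
    exact one_ne_zero this
  have hact1 : AffExt.act φ (1 : ZMod n) = φ := by
    rw [AffExt.act, ZMod.val_one, pow_one]
  have hinj : Function.Injective (AffExt.lift e y hyn hy) := by
    refine AffExt.lift_injective e y hyn hy he fun t v htv => ?_
    -- `y^t ∈ W` is fixed by conjugation, hence trivial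
    have hmem : y ^ t.val ∈ W := by rw [htv, he_apply]; exact (Additive.toMul v).2
    have hfx : y * y ^ t.val * y⁻¹ = y ^ t.val := by group
    have hyt : y ^ t.val = 1 := hfixW _ hmem hfx
    have ht : orderOf y ∣ t.val := orderOf_dvd_of_pow_eq_one hyt
    exact (ZMod.val_eq_zero t).1 (Nat.eq_zero_of_dvd_of_lt ht (ZMod.val_lt t))
  -- a linear functional `λ : A → 𝔽_p` with `λ a ≠ 0`
  have hpA : ∀ v : A, p • v = 0 := by
    intro v
    change Additive.ofMul ((Additive.toMul v) ^ p) = Additive.ofMul 1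
    rw [show (Additive.toMul v) ^ p = 1 from Subtype.ext (by
      rw [Subgroup.coe_pow, Subgroup.coe_one]; exact hWp _ (Additive.toMul v).2)]
  let a₀ : A := Additive.ofMul ⟨a, haW⟩
  have ha₀ : a₀ ≠ 0 := by
    intro h0
    have := congrArg (fun v : A => ((Additive.toMul v : W) : H)) h0
    exact ha1 this
  obtain ⟨lam, hf⟩ := CoprimeAtom.exists_addMonoidHom_ne_zero hpA ha₀
  -- the sequence `s i = λ(yⁱ a y⁻ⁱ)`
  let cA : ℕ → A := fun i => Additive.ofMul ⟨c' i, hc'mem i⟩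
  have hcA0 : cA 0 = a₀ := by
    apply Additive.toMul.injective; apply Subtype.ext
    change y ^ 0 * a * (y ^ 0)⁻¹ = a; simp
  have hφcA : ∀ i, φ (cA i) = cA (i + 1) := fun i => by
    apply Additive.toMul.injective; apply Subtype.ext; exact hc'succ i
  have hcAq : ∀ i, cA (i + q) = cA i := by
    intro i; apply Additive.toMul.injective; apply Subtype.ext
    change y ^ (i + q) * a * (y ^ (i + q))⁻¹ = y ^ i * a * (y ^ i)⁻¹
    rw [pow_add, mul_inv_rev, show y ^ i * y ^ q * a * ((y ^ q)⁻¹ * (y ^ i)⁻¹) =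
      y ^ i * (y ^ q * a * (y ^ q)⁻¹) * (y ^ i)⁻¹ by group, hyq]
  have hprod : ∀ m, ((Additive.toMul (∑ i ∈ range m, cA i) : W) : H) = conjTrace y a m := by
    intro m
    induction m with
    | zero => simp
    | succ m ih =>
      rw [sum_range_succ, toMul_add, Subgroup.coe_mul, ih, conjTrace_succ']
      rfl
  have hsumA : ∑ i ∈ range q, cA i = 0 := by
    apply Additive.toMul.injective; apply Subtype.ext
    rw [hprod, htr]; rfl
  let s : ℕ → ZMod p := fun i => lam (cA i)
  have hsq : ∀ i, s (i + q) = s i := fun i => by simp only [s, hcAq]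
  have hsum : ∑ i ∈ range q, s i = 0 := by
    simp only [s, ← map_sum, hsumA, map_zero]
  have hs0 : s 0 ≠ 0 := by simp only [s, hcA0]; exact hf
  obtain ⟨i, hdet⟩ := CoprimeAtom.exists_det_ne_zero hq hpq hroot s hsq hsum hs0
  -- joint surjectivity of `(λ, λ ∘ φ)`
  have hpair : ∀ x z : ZMod p, ∃ v : A, lam v = x ∧ lam (AffExt.act φ (1 : ZMod n) v) = z := by
    intro x z
    rw [hact1]
    -- Cramer: `v = k • cA 0 + l • cA i`
    obtain ⟨k, hk⟩ : ∃ k : ZMod p, k = (x * s (i + 1) - z * s i) / (s 0 * s (i + 1) - s 1 * s i) := ⟨_, rfl⟩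
    obtain ⟨l, hl⟩ : ∃ l : ZMod p, l = (z * s 0 - x * s 1) / (s 0 * s (i + 1) - s 1 * s i) := ⟨_, rfl⟩
    refine ⟨(k.val : ℤ) • cA 0 + (l.val : ℤ) • cA i, ?_, ?_⟩
    · rw [map_add, map_zsmul, map_zsmul, zsmul_eq_mul, zsmul_eq_mul, Int.cast_natCast, Int.cast_natCast,
        ZMod.natCast_zmod_val, ZMod.natCast_zmod_val]
      change k * s 0 + l * s i = x
      rw [hk, hl, div_mul_eq_mul_div, div_mul_eq_mul_div, ← add_div, div_eq_iff hdet]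
      ring
    · rw [map_add, map_zsmul, map_zsmul, hφcA, hφcA, map_add, map_zsmul, map_zsmul, zsmul_eq_mul, zsmul_eq_mul,
        Int.cast_natCast, Int.cast_natCast, ZMod.natCast_zmod_val, ZMod.natCast_zmod_val]
      change k * s (0 + 1) + l * s (i + 1) = z
      rw [zero_add, hk, hl, div_mul_eq_mul_div, div_mul_eq_mul_div, ← add_div, div_eq_iff hdet]
      ring
  have hfix : ∀ v : A, AffExt.act φ (1 : ZMod n) v = v → v = 0 := by
    intro v hv
    rw [hact1] at hv
    have hv' : y * ((Additive.toMul v : W) : H) * y⁻¹ = (Additive.toMul v : W) :=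
      congrArg (fun w : A => ((Additive.toMul w : W) : H)) hv
    have := hfixW _ (Additive.toMul v).2 hv'
    apply Additive.toMul.injective
    exact Subtype.ext this
  have hmodel : ¬ BoxUseful (AffExt A n φ) := AffExt.not_boxUseful_of_twoRotation φ lam hpair hfix h1
  unfold BoxUseful at hmodel
  push Not at hmodel
  obtain ⟨Y', W', hY', hW', I, hI, hind, hbig⟩ := hmodel
  exact not_boxUseful_of_injective _ hinj hY' hW' hI hind hbig

/-- **`q ∤ p − 1` ⇒ `AtomBad p q`** (primes `p ≠ q`): the order of any `q`-th root of unity mod `p` divides `p − 1`. [folklore] -/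
theorem atomBad_of_not_dvd {p q : ℕ} [hp : Fact p.Prime] (hq : q.Prime) (hpq : p ≠ q) (hndvd : ¬ q ∣ p - 1) :
    AtomBad.{u} p q := by
  haveI : Fact q.Prime := ⟨hq⟩
  refine atomBad_of_no_root hq hpq fun r hr => ?_
  by_contra hr1
  have hr0 : r ≠ 0 := by rintro rfl; rw [zero_pow hq.ne_zero] at hr; exact zero_ne_one hr
  have hord : orderOf r = q := orderOf_eq_prime hr hr1
  exact hndvd (hord ▸ ZMod.orderOf_dvd_card_sub_one hr0)

end Summit.MatrixMultiplication.OmegaCensus
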